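import Mathlib

/-!
# Apex foam, part 1: the fold profile (negative-side support for `stub_slabApexBound`, line `Sketch` of the
  crux `SlicedKelvin.PlanarFluxAPriori`, stmt-NavierStokesRegularity-15600)

Refuter cdisprove seat g2, cycle 1 (2026-08-17). The only open stub of the lead's skeleton
`Cruxes/PlanarFluxAPriori/Lines/Sketch.lean` (rev 4) is `stub_slabApexBound`: along a classical Leray–Hopf solution
and for `t₀ > 0`, the ε-APEX FUNCTIONAL `liminf_{ε→0⁺} ∫_{|⟪x,Re₂⟫−c|<h} (ε²/√(f²+ε²)³)|Df[curl u(t)]|`,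
`f = ⟪curl u(t), R e₂⟫`, is bounded uniformly in `t ∈ [t₀,T)`, frames `R` and heights `c`. The three files
`Negative/SlabApexBoundApexFoam{Profile,Field}.lean` + `Negative/SlabApexBoundFalseKinematic.lean` show that its
KINEMATIC form and its `t₀ = 0` form are FALSE (an "apex foam": infinitely many infinitesimal folds of the vortex
lines, each charged at full circulation weight by the functional).

This part is the 1-D FOLD BUDGET, for an arbitrary `C¹` profile `g : ℝ → ℝ`:
* the pattern `U = ⋃ₖ (1/(2k+3), 1/(2k+2)) ⊆ (0, 1/2]` with zeros `zₖ = 1/(2k+3) ∉ U` and peaks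
  `mₖ = 2/(4k+5) ∈ U`, the segments `[zₖ, mₖ]` being pairwise disjoint (a smooth `g ≥ 0` with `support g = U`
  EXISTS by Mathlib's `IsOpen.exists_contDiff_support_eq` — no hand-made flat oscillating function is needed);
* the regularised sign `H_ε(u) = u/√(u²+ε²)`, `H_ε' = ε²/√(u²+ε²)³` (`hasDerivAt_Hreg`), the apex density
  `ε²/√(g²+ε²)³·|g'| = |(H_ε∘g)'|` (`apexDensity`) and the FTC bound
  `H_ε(g(m))/2 ≤ ∫_{(z,m]} apexDensity/2` when `g(z) = 0` (`ofReal_Hreg_le_lintegral`): every fold is charged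
  `≥ 1/4` as soon as `ε ≤ g(m)` (`half_le_Hreg`), however small `g(m)` is;
* the bookkeeping `Σ_{k<K} ∫_{(zₖ,mₖ]} F ≤ ∫_{[0,1]} F` (`sum_lintegral_le_lintegral_Icc`).

Mathlib only.
-/

noncomputable section

-- Problem = summit for this single-conjunct summit: the duplicate namespace component is deliberate.
set_option linter.dupNamespace false

namespace Summit.NavierStokesRegularity.NavierStokesRegularity.Theorems.PlanarFluxAPriori.Negative.ApexFoam

open MeasureTheory Set Function Filter Topology
open scoped ENNReal

/-! ### 1-D data: the fold pattern -/

/-- left endpoints (zeros) -/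
def za (k : ℕ) : ℝ := 1 / (2 * (k : ℝ) + 3)
/-- right endpoints -/
def zb (k : ℕ) : ℝ := 1 / (2 * (k : ℝ) + 2)
/-- interior points -/
def zm (k : ℕ) : ℝ := 2 / (4 * (k : ℝ) + 5)

/-- the open set carrying the folds -/
def U : Set ℝ := ⋃ k : ℕ, Ioo (za k) (zb k)

/-- The zeros are positive. -/
theorem za_pos (k : ℕ) : 0 < za k := by unfold za; positivity
/-- `zₖ < mₖ`. -/
theorem za_lt_zm (k : ℕ) : za k < zm k := by
  unfold za zm; rw [div_lt_div_iff₀ (by positivity) (by positivity)]; nlinarith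
/-- `mₖ` lies in the `k`-th interval. -/
theorem zm_lt_zb (k : ℕ) : zm k < zb k := by
  unfold zm zb; rw [div_lt_div_iff₀ (by positivity) (by positivity)]; nlinarith
/-- All intervals lie in `(0, 1/2]`. -/
theorem zb_le_half (k : ℕ) : zb k ≤ 1 / 2 := by
  unfold zb
  rw [div_le_div_iff₀ (by positivity) (by positivity)]; nlinarith [(Nat.cast_nonneg k : (0:ℝ) ≤ k)]
/-- The segments `[zₖ, mₖ]` are ordered from right to left: `m_{k'} < zₖ` for `k < k'`. -/
theorem zm_succ_lt_za {k k' : ℕ} (h : k < k') : zm k' < za k := by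
  unfold zm za
  have h' : (k:ℝ) + 1 ≤ k' := by exact_mod_cast h
  rw [div_lt_div_iff₀ (by positivity) (by positivity)]; nlinarith

/-- The zeros `zₖ = 1/(2k+3)` are not in `U` (a profile supported in `U` vanishes there). -/
theorem za_not_mem_U (k : ℕ) : za k ∉ U := by
  simp only [U, mem_iUnion, mem_Ioo, not_exists, not_and]
  intro j h1 h2
  unfold za zb at *
  rw [div_lt_div_iff₀ (by positivity) (by positivity)] at h1 h2
  have h1' : (k:ℝ) < j := by nlinarith
  have h2' : (2:ℝ) * j + 2 < 2 * k + 3 := by nlinarith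
  have h1'' : k < j := by exact_mod_cast h1'
  have h2'' : 2 * j + 2 < 2 * k + 3 := by exact_mod_cast h2'
  omega

/-- The peaks `mₖ` are in `U` (a profile with support `U` is nonzero there). -/
theorem zm_mem_U (k : ℕ) : zm k ∈ U := mem_iUnion.2 ⟨k, za_lt_zm k, zm_lt_zb k⟩

/-- `U ⊆ (0, 1/2]`. -/
theorem U_subset : U ⊆ Ioc 0 (1 / 2) := by
  intro s hs
  obtain ⟨k, hk⟩ := mem_iUnion.1 hs
  exact ⟨(za_pos k).trans hk.1, hk.2.le.trans (zb_le_half k)⟩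

/-- The regularised sign function `H_ε(u) = u / √(u² + ε²)`. -/
def Hreg (ε u : ℝ) : ℝ := u / Real.sqrt (u ^ 2 + ε ^ 2)

/-- `H_ε' (u) = ε² / √(u² + ε²)³` (`ε ≠ 0`). -/
theorem hasDerivAt_Hreg {ε : ℝ} (hε : ε ≠ 0) (u : ℝ) :
    HasDerivAt (Hreg ε) (ε ^ 2 / Real.sqrt (u ^ 2 + ε ^ 2) ^ 3) u := by
  have hpos : 0 < u ^ 2 + ε ^ 2 := by positivity
  have hs : 0 < Real.sqrt (u ^ 2 + ε ^ 2) := Real.sqrt_pos.2 hpos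
  have hsq : Real.sqrt (u ^ 2 + ε ^ 2) ^ 2 = u ^ 2 + ε ^ 2 := Real.sq_sqrt hpos.le
  have h1 : HasDerivAt (fun u => u ^ 2 + ε ^ 2) (2 * u) u := by
    simpa using (hasDerivAt_pow 2 u).add_const (ε ^ 2)
  have h2 : HasDerivAt (fun u => Real.sqrt (u ^ 2 + ε ^ 2)) (2 * u / (2 * Real.sqrt (u ^ 2 + ε ^ 2))) u :=
    h1.sqrt hpos.ne'
  have h3 : HasDerivAt (Hreg ε)
      ((1 * Real.sqrt (u ^ 2 + ε ^ 2) - u * (2 * u / (2 * Real.sqrt (u ^ 2 + ε ^ 2)))) /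
        Real.sqrt (u ^ 2 + ε ^ 2) ^ 2) u := (hasDerivAt_id u).div h2 hs.ne'
  convert h3 using 1
  have h3' : Real.sqrt (u ^ 2 + ε ^ 2) ^ 3 = Real.sqrt (u ^ 2 + ε ^ 2) * (u ^ 2 + ε ^ 2) := by
    rw [pow_succ', hsq]
  rw [h3', hsq]
  field_simp
  nlinarith [hsq, hs]

/-- `H_ε(0) = 0`. -/
theorem Hreg_zero (ε : ℝ) : Hreg ε 0 = 0 := by simp [Hreg]

/-- Once `0 < ε ≤ w`, the regularised sign of `w` is at least `1/2`. -/
theorem half_le_Hreg {ε w : ℝ} (hε : 0 < ε) (hw : ε ≤ w) : 1 / 2 ≤ Hreg ε w := by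
  have hw0 : 0 < w := hε.trans_le hw
  have hs : 0 < Real.sqrt (w ^ 2 + ε ^ 2) := Real.sqrt_pos.2 (by positivity)
  have hle : Real.sqrt (w ^ 2 + ε ^ 2) ≤ 2 * w := by
    calc Real.sqrt (w ^ 2 + ε ^ 2) ≤ Real.sqrt ((2 * w) ^ 2) :=
          Real.sqrt_le_sqrt (by nlinarith)
      _ = 2 * w := Real.sqrt_sq (by positivity)
  unfold Hreg
  rw [div_le_div_iff₀ (by norm_num) hs]
  linarith

/-- The ε-apex density of a profile `g`: `ε² / √(g² + ε²)³ · |g'|` (`= |(H_ε ∘ g)'|`). -/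
def apexDensity (ε : ℝ) (g : ℝ → ℝ) (s : ℝ) : ℝ :=
  ε ^ 2 / Real.sqrt (g s ^ 2 + ε ^ 2) ^ 3 * |deriv g s|

/-- The apex density is nonnegative. -/
theorem apexDensity_nonneg (ε : ℝ) (g : ℝ → ℝ) (s : ℝ) : 0 ≤ apexDensity ε g s := by
  unfold apexDensity; positivity

/-- The apex density of a `C¹` profile is continuous. -/
theorem continuous_apexDensity (ε : ℝ) {g : ℝ → ℝ} (hg : ContDiff ℝ 1 g) :
    Continuous (apexDensity ε g) := by
  unfold apexDensity
  have hc : Continuous g := hg.continuous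
  have hd : Continuous (deriv g) := hg.continuous_deriv le_rfl
  rcases eq_or_ne ε 0 with rfl | hε
  · simp only [ne_eq, OfNat.ofNat_ne_zero, not_false_eq_true, zero_pow, zero_div, zero_mul]
    exact continuous_const
  exact (continuous_const.div (((hc.pow 2).add continuous_const).sqrt.pow 3) fun s =>
    (pow_pos (Real.sqrt_pos.2 (show 0 < g s ^ 2 + ε ^ 2 by positivity)) 3).ne').mul hd.abs

/-- **FTC lower bound.** Along a segment `[a, m]` with `g a = 0`, the (halved) ε-apex density integrates to
at least the jump `H_ε(g m)/2` of the regularised sign. -/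
theorem ofReal_Hreg_le_lintegral {ε : ℝ} (hε : ε ≠ 0) {g : ℝ → ℝ} (hg : ContDiff ℝ 1 g) {a m : ℝ}
    (ham : a ≤ m) (hga : g a = 0) :
    ENNReal.ofReal (Hreg ε (g m) / 2) ≤ ∫⁻ s in Ioc a m, ENNReal.ofReal (apexDensity ε g s / 2) := by
  -- the primitive and its derivative
  set φ : ℝ → ℝ := fun s => Hreg ε (g s) / 2 with hφ
  set φ' : ℝ → ℝ := fun s => ε ^ 2 / Real.sqrt (g s ^ 2 + ε ^ 2) ^ 3 * deriv g s / 2 with hφ'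
  have hderiv : ∀ s, HasDerivAt φ (φ' s) s := fun s => by
    have h1 : HasDerivAt g (deriv g s) s := (hg.differentiable one_ne_zero s).hasDerivAt
    have h2 := (hasDerivAt_Hreg hε (g s)).comp s h1
    exact h2.div_const 2
  have hcont' : Continuous φ' := by
    have hc : Continuous g := hg.continuous
    have hd : Continuous (deriv g) := hg.continuous_deriv le_rfl
    exact ((continuous_const.div (((hc.pow 2).add continuous_const).sqrt.pow 3) fun s =>
      (pow_pos (Real.sqrt_pos.2 (show 0 < g s ^ 2 + ε ^ 2 by positivity)) 3).ne').mul hd).div_const 2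
  have hpt : ∀ s, |φ' s| = apexDensity ε g s / 2 := fun s => by
    have h0 : 0 ≤ ε ^ 2 / Real.sqrt (g s ^ 2 + ε ^ 2) ^ 3 := by positivity
    simp only [hφ', apexDensity]
    rw [abs_div, abs_mul, abs_of_nonneg h0, abs_two]
  have hFTC : ∫ s in a..m, φ' s = φ m - φ a :=
    intervalIntegral.integral_eq_sub_of_hasDerivAt (fun s _ => hderiv s) (hcont'.intervalIntegrable _ _)
  have hφa : φ a = 0 := by simp [hφ, hga, Hreg_zero]
  have hval : Hreg ε (g m) / 2 = ∫ s in Ioc a m, φ' s := by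
    rw [← intervalIntegral.integral_of_le ham, hFTC, hφa, sub_zero]
  calc ENNReal.ofReal (Hreg ε (g m) / 2) = ENNReal.ofReal (∫ s in Ioc a m, φ' s) := by rw [hval]
    _ ≤ ‖∫ s in Ioc a m, φ' s‖ₑ := Real.ofReal_le_enorm _
    _ ≤ ∫⁻ s in Ioc a m, ‖φ' s‖ₑ := enorm_integral_le_lintegral_enorm _
    _ = ∫⁻ s in Ioc a m, ENNReal.ofReal (apexDensity ε g s / 2) := by
        refine lintegral_congr fun s => ?_
        rw [Real.enorm_eq_ofReal_abs, hpt s]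

/-- Summing the segment bounds over the first `K` folds inside `[0, 1]`. -/
theorem sum_lintegral_le_lintegral_Icc (F : ℝ → ℝ≥0∞) (K : ℕ) :
    (∑ k ∈ Finset.range K, ∫⁻ s in Ioc (za k) (zm k), F s) ≤ ∫⁻ s in Icc 0 1, F s := by
  have hd : Set.PairwiseDisjoint (↑(Finset.range K) : Set ℕ) (fun k => Ioc (za k) (zm k)) := by
    intro i _ j _ hij
    rcases lt_or_gt_of_ne hij with h | h
    · exact Set.disjoint_left.2 fun x hx hx' =>
        lt_irrefl _ ((hx.1.trans_le hx'.2).trans (zm_succ_lt_za h))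
    · exact Set.disjoint_left.2 fun x hx hx' =>
        lt_irrefl _ ((hx'.1.trans_le hx.2).trans (zm_succ_lt_za h))
  rw [← lintegral_biUnion_finset hd (fun k _ => measurableSet_Ioc)]
  refine lintegral_mono_set ?_
  intro s hs
  simp only [mem_iUnion, Finset.mem_range, exists_prop] at hs
  obtain ⟨k, -, hk⟩ := hs
  exact ⟨(za_pos k).le.trans hk.1.le, hk.2.trans ((zm_lt_zb k).le.trans ((zb_le_half k).trans (by norm_num)))⟩

end Summit.NavierStokesRegularity.NavierStokesRegularity.Theorems.PlanarFluxAPriori.Negative.ApexFoam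

end
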